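import Summits.Ventures.PercRepro.ThetaMulti

/-!
# σ(8) ≤ 11: an all-singleton instance of (Θ_∞) with eight classes and eleven differences

Dossier proofs/MINE1-theoremS.md, Addendum 72 suppl. 6 (mine-1, gen 38). The all-singleton minimum
`σ(k)` is the least `|multiD A|` over valid instances with `k` singleton classes; the census values
`σ(3..7) = 4, 4, 6, 8, 10` suggested `σ(k) = 2k − 4`. The family
`X = {∅, 03, 13, 013, 023, 123, 012, 23}` on `[4]` in eight singleton classes has exactly eleven
multi-class differences, so `σ(8) ≤ 11 < 12`: the conjecture fails from `k = 8` on
(kit j304304 found an instance at `K = 11` by SAT; this is the explicit one, kernel-checked).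
-/

namespace PercRepro.MSTight

open Finset

/-- The eight singleton classes of the witness. -/
def sigmaEightWitness : Fin 8 → Finset (Finset (Fin 4)) :=
  ![{∅}, {{0, 3}}, {{1, 3}}, {{0, 1, 3}}, {{0, 2, 3}}, {{1, 2, 3}}, {{0, 1, 2}}, {{2, 3}}]

/-- The witness is a valid instance. -/
theorem sigmaEightWitness_valid : MultiValid sigmaEightWitness := by
  unfold MultiValid sigmaEightWitness
  decide

/-- Every class of the witness is a singleton. -/
theorem sigmaEightWitness_card (i : Fin 8) : (sigmaEightWitness i).card = 1 := by
  fin_cases i <;> rfl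

set_option maxRecDepth 20000 in
/-- The witness has exactly eleven multi-class differences. -/
theorem card_multiD_sigmaEightWitness : (multiD sigmaEightWitness).card = 11 := by
  unfold multiD sigmaEightWitness crossD
  decide

/-- **σ(8) ≤ 11**: a valid instance with eight singleton classes and eleven multi-class
differences. -/
theorem sigma_eight_le_eleven :
    ∃ A : Fin 8 → Finset (Finset (Fin 4)),
      MultiValid A ∧ (∀ i, (A i).card = 1) ∧ (multiD A).card = 11 :=
  ⟨sigmaEightWitness, sigmaEightWitness_valid, sigmaEightWitness_card,
    card_multiD_sigmaEightWitness⟩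

end PercRepro.MSTight
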